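import Literature.AlgebraicGeometry.HodgeTheory.GAGATwistingSheavesProjectiveSpace
import HarnessLib

/-!
# GAGA for the free sheaves `⊕_j 𝒪(n - e_j)` on `ℙ_r(ℂ)` (Serre 1956, n° 13 Lemme 5, by Frenkel's
Laurent method)

The several-generator version of `GAGATwist.quasiIso_cechComparison`: for a finite index type
`J`, a shift `e : J → ℤ` and `n ∈ ℤ`, the tree's algebraic Čech complex
`LaurentCech.cech e ⊤ n` of the FREE graded module `F_e = ⊕_j P(-e_j)` in degree `n` — the
algebraic Čech complex of the sheaf `⊕_j 𝒪(n - e_j)` on `ℙ_r` for the standard cover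
[Serre FAC n° 64] — maps quasi-isomorphically onto the holomorphic ordered Čech complex of
`⊕_j 𝒪(n - e_j)^h` (sections over `U_s` = `J`-tuples of holomorphic functions on the cone `Û_s`,
the `j`-th homogeneous of degree `n - e_j`, Serre n° 16), `GAGAFree.quasiIso_cechComparison`.
Everything is componentwise over `J`: the ambient module is `𝕂^J` (`𝕂 = Γ(T, 𝒪)` =
`GAGATwist.holTorus r`), the families are the products of the one-generator families
`GAGATwist.holFamily` / `GAGATwist.algFamily`, Frenkel's operators `T_i`, `π` act coordinatewise,
and the relative cone-contraction criterion `OrderedCech.quasiIso_complexMap_of_coneRetraction`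
applies verbatim. This is the form in which Serre's dévissage (GAGA Théorème 1 for all coherent
algebraic sheaves on `ℙ_r(ℂ)`, via graded presentations `P^{J'} → P^J → M → 0`,
`LaurentCech.shortExact_presentationSC`) consumes Lemme 5.

## References
* [cite: SerreGAGA1956, n° 13 Lemme 5 and footnote (4); n° 16] J.-P. Serre, *Géométrie
  algébrique et géométrie analytique*, Ann. Inst. Fourier 6 (1956) 1–42.
* [cite: SerreFAC1955, n° 64] J.-P. Serre, *Faisceaux algébriques cohérents*, Ann. of Math. 61
  (1955) 197–278.
-/

noncomputable section

open Set Function CategoryTheory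

namespace Literature.AlgebraicGeometry.HodgeTheory

namespace GAGAFree

open Literature.Analysis.Complex.LaurentSeparation Literature.Algebra.Homology
  Literature.Algebra.Homology.LaurentCech Literature.Algebra.Homology.OrderedCech GAGATwist

variable {r : ℕ} {J : Type} (e : J → ℤ) (n : ℤ)

/-! ### The families -/

variable (r) in
/-- **The holomorphic sections `Γ(U_s, ⊕_j 𝒪(n - e_j)^h)`** inside `𝕂^J`: `J`-tuples whose `j`-th
member lies in `F_{n - e_j}(s)` (agrees on the torus with a holomorphic function on `Û_s`
homogeneous of degree `n - e_j`). [cite: SerreGAGA1956, n° 16 and n° 13 Lemme 5] -/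
def holFamily (s : Finset (Fin (r + 1))) : Submodule ℂ (J → holTorus r) :=
  Submodule.pi Set.univ fun j => GAGATwist.holFamily r (n - e j) s

/-- Membership in the product family. [cite: SerreGAGA1956, n° 16] -/
theorem mem_holFamily {s : Finset (Fin (r + 1))} {f : J → holTorus r} :
    f ∈ holFamily r e n s ↔ ∀ j, f j ∈ GAGATwist.holFamily r (n - e j) s := by
  simp [holFamily, Submodule.mem_pi]

/-- `s ↦ F(s)` is monotone. [cite: SerreGAGA1956, n° 16] -/
theorem holFamily_mono : Monotone (holFamily r e n) := fun _ _ hst _ hf =>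
  (mem_holFamily e n).2 fun j => GAGATwist.holFamily_mono _ hst ((mem_holFamily e n).1 hf j)

variable (r) in
/-- **The algebraic sections `Γ(U_s, ⊕_j 𝒪(n - e_j))`** inside `𝕂^J`: `J`-tuples whose `j`-th member
is (the evaluation of) a Laurent polynomial of degree `n - e_j` with poles along `s`.
[cite: SerreGAGA1956, n° 13 Lemme 5] [cite: SerreFAC1955, n° 64] -/
def algFamily (s : Finset (Fin (r + 1))) : Submodule ℂ (J → holTorus r) :=
  Submodule.pi Set.univ fun j => GAGATwist.algFamily r (n - e j) s

/-- Membership in the product family. [cite: SerreFAC1955, n° 64] -/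
theorem mem_algFamily {s : Finset (Fin (r + 1))} {f : J → holTorus r} :
    f ∈ algFamily r e n s ↔ ∀ j, f j ∈ GAGATwist.algFamily r (n - e j) s := by
  simp [algFamily, Submodule.mem_pi]

/-- `s ↦ G(s)` is monotone. [cite: SerreFAC1955, n° 64] -/
theorem algFamily_mono : Monotone (algFamily r e n) := fun _ _ hst _ hf =>
  (mem_algFamily e n).2 fun j => GAGATwist.algFamily_mono _ hst ((mem_algFamily e n).1 hf j)

/-- `G(s) ≤ F(s)`. [cite: SerreGAGA1956, n° 13 Lemme 5] -/
theorem algFamily_le_holFamily (s : Finset (Fin (r + 1))) : algFamily r e n s ≤ holFamily r e n s :=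
  fun _ hf => (mem_holFamily e n).2 fun j =>
    GAGATwist.algFamily_le_holFamily _ s ((mem_algFamily e n).1 hf j)

/-! ### The localized pieces of the free module, componentwise -/

/-- **The localized piece of the free graded module is the product of the one-generator pieces**:
`v ∈ ((F_e)_{x_s})_n` iff `v_j ∈ (P_{x_s})_{n - e_j}` for every `j`.
[cite: SerreFAC1955, n° 64] -/
theorem mem_locDeg_iff_forall [Finite J] (s : Finset (Fin (r + 1))) (v : J → L ℂ r) :
    v ∈ locDeg e (⊤ : Submodule (P ℂ r) (J → P ℂ r)) s n ↔
      ∀ j, (fun _ : Unit => v j) ∈ locDeg (fun _ : Unit => (0 : ℤ)) (Ktop r) s (n - e j) := by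
  constructor
  · intro hv j
    rw [mem_locDeg, mem_loc, mem_Kdeg] at hv
    obtain ⟨⟨N, k, -, hk⟩, hdeg⟩ := hv
    have hj := congr_fun hk j
    rw [Pi.smul_apply, smul_eq_mul, ιK_apply] at hj
    exact mem_locDeg_of hj (hdeg j)
  · intro hv
    haveI := Fintype.ofFinite J
    choose N p hNp using fun j => (exists_of_mem_locDeg (hv j)).1
    have hdeg := fun j => (exists_of_mem_locDeg (hv j)).2
    rw [mem_locDeg, mem_loc, mem_Kdeg]
    refine ⟨⟨∑ j, N j, fun j => Xs ℂ s ^ (∑ j, N j - N j) * p j, trivial, ?_⟩, fun j => hdeg j⟩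
    funext j
    have hle : N j ≤ ∑ j, N j :=
      Finset.single_le_sum (f := N) (fun _ _ => Nat.zero_le _) (Finset.mem_univ j)
    rw [Pi.smul_apply, smul_eq_mul, ιK_apply, map_mul, toL_Xs_pow, ← hNp j, ← mul_assoc, ← xs_add]
    congr 2
    push_cast [Nat.cast_sub hle]
    ring

/-! ### The comparison map -/

variable (r) in
/-- **Componentwise evaluation `ψ : L^J → 𝕂^J`.** [cite: SerreGAGA1956, n° 13 Lemme 5] -/
def ψ : (J → L ℂ r) →ₗ[ℂ] (J → holTorus r) := (holEval r).compLeft J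

/-- `(ψ v) j = holEval (v j)`. [cite: SerreGAGA1956, n° 13 Lemme 5] -/
@[simp] theorem ψ_apply (v : J → L ℂ r) (j : J) : ψ r v j = holEval r (v j) := rfl

/-- `ψ` maps the localized piece onto the algebraic family. [cite: SerreGAGA1956, n° 13 Lemme 5] -/
theorem ψ_mem_algFamily [Finite J] {s : Finset (Fin (r + 1))} {v : J → L ℂ r}
    (hv : v ∈ locDeg e (⊤ : Submodule (P ℂ r) (J → P ℂ r)) s n) : ψ r v ∈ algFamily r e n s :=
  (mem_algFamily e n).2 fun j => by
    obtain ⟨⟨N, p, hp⟩, hdeg⟩ := exists_of_mem_locDeg ((mem_locDeg_iff_forall e n s v).1 hv j)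
    rw [ψ_apply]
    exact holEval_mem_algFamily hp hdeg

/-- Every member of the algebraic family is `ψ` of a member of the localized piece.
[cite: SerreGAGA1956, n° 13 Lemme 5] -/
theorem exists_eq_ψ_of_mem_algFamily [Finite J] {s : Finset (Fin (r + 1))} {f : J → holTorus r}
    (hf : f ∈ algFamily r e n s) :
    ∃ v ∈ locDeg e (⊤ : Submodule (P ℂ r) (J → P ℂ r)) s n, ψ r v = f := by
  rw [mem_algFamily] at hf
  choose v hv hvf using hf
  refine ⟨fun j => v j (), (mem_locDeg_iff_forall e n s _).2 fun j => hv j, funext fun j => ?_⟩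
  rw [ψ_apply, ← hvf j, GAGATwist.ψ_apply]

/-- `ψ` is injective. [cite: SerreGAGA1956, n° 13 Lemme 5] -/
theorem ψ_eq_zero {v : J → L ℂ r} (hv : ψ r v = 0) : v = 0 := by
  funext j
  have := congr_fun hv j
  rw [ψ_apply, Pi.zero_apply, ← (holEval r).map_zero] at this
  exact holEval_injective this

variable (r) in
/-- **The holomorphic ordered Čech complex `Č•(𝔘^h; ⊕_j 𝒪(n - e_j)^h)` of `ℙ_r(ℂ)`** for the
standard cover, in Serre's cone description. [cite: SerreGAGA1956, n° 13 Lemme 5] -/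
def holCech : CochainComplex (ModuleCat.{0} ℂ) ℤ :=
  OrderedCech.complex (holFamily r e n) (holFamily_mono e n)

variable (r) in
/-- **The GAGA comparison map for `⊕_j 𝒪(n - e_j)` on `ℙ_r(ℂ)`**: componentwise evaluation of the
algebraic Čech cochains of the free graded module (`LaurentCech.cech e ⊤ n`, FAC n° 64) as
holomorphic Čech cochains. [cite: SerreGAGA1956, n° 13 Lemme 5] -/
def cechComparison [Finite J] :
    LaurentCech.cech e (⊤ : Submodule (P ℂ r) (J → P ℂ r)) n ⟶ holCech r e n :=
  OrderedCech.complexMap (ψ r) (fun s _ hv => algFamily_le_holFamily e n s (ψ_mem_algFamily e n hv))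
    (locDeg_mono e _ n) (holFamily_mono e n)

/-! ### Frenkel's operators, componentwise -/

/-- `Σ_i T_i + π = id` on `𝕂^J`. [cite: SerreGAGA1956, n° 13 footnote (4)] -/
theorem sum_Top_add_πop_apply (f : J → holTorus r) :
    ∑ i, (Top r i).compLeft J f + (πop r).compLeft J f = f := by
  funext j
  simp only [Pi.add_apply, Finset.sum_apply, LinearMap.compLeft_apply, comp_apply]
  exact GAGATwist.sum_Top_add_πop_apply (f j)

/-- `T_i (F(s ∪ i)) ⊆ F(s)`, componentwise. [cite: SerreGAGA1956, n° 13 footnote (4)] -/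
theorem Top_mem_holFamily (i : Fin (r + 1)) (s : Finset (Fin (r + 1))) :
    ∀ f ∈ holFamily r e n (insert i s), (Top r i).compLeft J f ∈ holFamily r e n s :=
  fun _ hf => (mem_holFamily e n).2 fun j =>
    GAGATwist.Top_mem_holFamily _ i s _ ((mem_holFamily e n).1 hf j)

/-- `T_i (G(s ∪ i)) ⊆ G(s)`, componentwise. [cite: SerreGAGA1956, n° 13 footnote (4)] -/
theorem Top_mem_algFamily (i : Fin (r + 1)) (s : Finset (Fin (r + 1))) :
    ∀ f ∈ algFamily r e n (insert i s), (Top r i).compLeft J f ∈ algFamily r e n s :=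
  fun _ hf => (mem_algFamily e n).2 fun j =>
    GAGATwist.Top_mem_algFamily _ i s _ ((mem_algFamily e n).1 hf j)

/-- `π (F(s)) ⊆ G(s)` for nonempty `s`, componentwise (Lemme 4 in each coordinate).
[cite: SerreGAGA1956, n° 13 Lemmes 4–5] -/
theorem πop_mem_algFamily :
    ∀ s : Finset (Fin (r + 1)), s.Nonempty → ∀ f ∈ holFamily r e n s,
      (πop r).compLeft J f ∈ algFamily r e n s :=
  fun s hs _ hf => (mem_algFamily e n).2 fun j =>
    GAGATwist.πop_mem_algFamily _ s hs _ ((mem_holFamily e n).1 hf j)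

/-- `F(∅) ≤ G(∅)`, componentwise. [cite: SerreGAGA1956, n° 13 Lemme 5] -/
theorem holFamily_empty_le : holFamily r e n ∅ ≤ algFamily r e n ∅ :=
  fun _ hf => (mem_algFamily e n).2 fun j =>
    GAGATwist.holFamily_empty_le _ ((mem_holFamily e n).1 hf j)

/-! ### The comparison theorem -/

/-- **Serre's GAGA Théorème 1 for the free sheaves `⊕_j 𝒪(n - e_j)` on `ℙ_r(ℂ)` (n° 13 Lemme 5),
by Frenkel's Laurent method.** For a finite `J`, a shift `e : J → ℤ` and `n ∈ ℤ`, the comparison map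
from the algebraic Čech complex `LaurentCech.cech e ⊤ n` of the free graded module to the
holomorphic ordered Čech complex of `⊕_j 𝒪(n - e_j)^h` on the standard cover is a
quasi-isomorphism. [cite: SerreGAGA1956, n° 13 Lemme 5 and footnote (4)] -/
theorem quasiIso_cechComparison [Finite J] : QuasiIso (cechComparison r e n) := by
  have hGF := algFamily_le_holFamily (r := r) e n
  haveI hq : QuasiIso (complexMap LinearMap.id (id_mapsTo_of_le hGF) (algFamily_mono e n)
      (holFamily_mono e n)) :=
    quasiIso_complexMap_of_coneRetraction (holFamily_mono e n) (algFamily_mono e n) hGF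
      (fun i => (Top r i).compLeft J) id ((πop r).compLeft J) (fun k s => Top_mem_holFamily e n k s)
      (fun k s => Top_mem_algFamily e n k s) (πop_mem_algFamily e n)
      (fun s _ f _ => sum_Top_add_πop_apply f) (holFamily_empty_le e n)
  set φ : LaurentCech.cech e (⊤ : Submodule (P ℂ r) (J → P ℂ r)) n ⟶
      complex (algFamily r e n) (algFamily_mono e n) :=
    complexMap (ψ r) (fun s _ hv => ψ_mem_algFamily e n hv) (locDeg_mono e _ n)
      (algFamily_mono e n) with hφ
  haveI : ∀ k, IsIso (φ.f k) := fun k => by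
    rw [hφ, complexMap_f, ConcreteCategory.isIso_iff_bijective]
    refine ⟨Cochain.map_injective (ψ r) (fun s _ hv => ψ_mem_algFamily e n hv)
        (fun s _ _ hv => ψ_eq_zero hv),
      Cochain.map_surjective (ψ r) (fun s _ hv => ψ_mem_algFamily e n hv) fun s y hy => ?_⟩
    obtain ⟨v, hv, rfl⟩ := exists_eq_ψ_of_mem_algFamily e n hy
    exact ⟨v, hv, rfl⟩
  haveI : IsIso φ := HomologicalComplex.Hom.isIso_of_components φ
  haveI hφq : QuasiIso φ := inferInstance
  have hcomp : cechComparison r e n =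
      φ ≫ complexMap LinearMap.id (id_mapsTo_of_le hGF) (algFamily_mono e n)
        (holFamily_mono e n) := by
    refine HomologicalComplex.hom_ext _ _ fun k => ?_
    rw [HomologicalComplex.comp_f, hφ, cechComparison, complexMap_f, complexMap_f, complexMap_f]
    rfl
  rw [hcomp]
  exact quasiIso_comp (hφ := hφq) (hφ' := hq)

/-- **The GAGA isomorphism on Čech cohomology for `⊕_j 𝒪(n - e_j)` on `ℙ_r(ℂ)`**, all degrees.
[cite: SerreGAGA1956, n° 13 Lemme 5] -/
theorem isIso_homologyMap_cechComparison [Finite J] (q : ℤ) :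
    IsIso (HomologicalComplex.homologyMap (cechComparison r e n) q) := by
  haveI := quasiIso_cechComparison (r := r) e n
  infer_instance

end GAGAFree

end Literature.AlgebraicGeometry.HodgeTheory
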